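import Mathlib
import Literature.Computability.AlgebraicComplexity.DeterminantalConormalBoundPlane
import Literature.RingTheory.MvPolynomial.LinearFormsCoeff
import Summits.ValiantsHypothesis.ValiantsHypothesis.Theorems.RigidityForcesSymmetryRankRigidMinimalReprLaplaceFiveStarWedgePoly
import Summits.ValiantsHypothesis.ValiantsHypothesis.Theorems.RigidityForcesSymmetryRankRigidMinimalReprLaplaceFiveStarExchange

/-!
# ValiantsHypothesis / RigidityForcesSymmetry — crux `LaplaceOptimalFive` (stmt-ValiantsHypothesis-24813), crux idea
`young-shadow` (K1) on the star: **LEMMA K, EXIT (I) — POLYNOMIAL COEFFICIENTS: THE HESSIAN-SYMMETRY ENDGAME**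
(referee note `NOTE-crit3g5-24813-Lemma2prime-elementary.md` §B (c2), last paragraph; memo `NOTE-p4g15-24813-K1-star.md` §14)

Exit (I) of the denominator trichotomy (✓ `LaplaceFiveStar.denominator_trichotomy`): `∂K = α ∂Q₁ + β ∂Q₂` with POLYNOMIALS `α, β`
(`Q_i = Σ C(U_i a b) X_a X_b` two independent symmetric quadrics, `K = Σ C(W a b c) X_a X_b X_c` a cubic).  Then:

* `isHomogeneous_of_mul_eq` — `α, β` are LINEAR FORMS (`α M₀ = N₀` with `M₀ ≠ 0` a quadric and `N₀` a cubic form);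
* `hessian_exchange` — symmetry of `∂_z∂_x K` gives the letter identity `a_z U₁(x,w) + b_z U₂(x,w) = a_x U₁(z,w) + b_x U₂(z,w)` for
  the (constant) gradients `a = ∇α`, `b = ∇β`;
* `endgame_of_polynomial_coefficients` — hence EITHER `a ∦ b` and every column of `U₁, U₂` lies in `span{a, b}` (BINARY pencil,
  ✓ `columns_in_span_of_symmetric_tensor`), OR `a ∥ b ≠ 0` and a non-trivial member `s U₁ + t U₂ = λλᵀ` is a SQUARE
  (✓ `square_of_symmetric_tensor`), OR `a = b = 0`, `∂K = 0`, `K = 0` (Euler, ✓ `euler_cubic`).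

Also: `pderiv_comm` (partial derivatives commute), `pderiv_sum_smul_X`, `pderiv_pderiv_quadric`.  Pure algebra; no star hypotheses,
no definitions, no `sorry`.  Honest framing: helper toward the Lean price (L2) of the K1-on-the-star theorem (PAPER, referee PASS; not
kernel); `LaplaceOptimalFive` OPEN · CONTESTED 72/120; `VP ≠ VNP` NOT proved.
-/

set_option linter.dupNamespace false

namespace Summit.ValiantsHypothesis.ValiantsHypothesis.Theorems.RigidityForcesSymmetryRankRigidMinimalRepr

namespace LaplaceFiveStar

open Finset MvPolynomial

/-- Partial derivatives commute: `∂_i ∂_j f = ∂_j ∂_i f` (any commutative semiring of coefficients). [folklore] -/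
theorem pderiv_comm {R : Type*} [CommSemiring R] {σ : Type*} (i j : σ) (f : MvPolynomial σ R) :
    pderiv i (pderiv j f) = pderiv j (pderiv i f) := by
  classical
  rcases eq_or_ne i j with rfl | hij
  · rfl
  induction f using MvPolynomial.induction_on' with
  | monomial s a =>
    simp only [pderiv_monomial, Finsupp.tsub_apply, Finsupp.single_apply, if_neg hij, if_neg hij.symm, tsub_zero]
    rw [tsub_right_comm]
    congr 1
    ring
  | add p q hp hq => rw [map_add, map_add, hp, hq, map_add, map_add]

/-- `∂_z (Σ_l a_l • X_l) = C a_z`. [folklore] -/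
theorem pderiv_sum_smul_X {R : Type*} [CommSemiring R] {σ : Type*} [Fintype σ] [DecidableEq σ] (a : σ → R) (z : σ) :
    pderiv z (∑ l, a l • (X l : MvPolynomial σ R)) = C (a z) := by
  rw [map_sum]
  simp only [Derivation.map_smul, pderiv_X, Pi.single_apply]
  rw [Finset.sum_eq_single z]
  · rw [if_pos rfl, smul_eq_C_mul, mul_one]
  · intro l _ hl
    rw [if_neg hl, smul_zero]
  · intro h
    exact absurd (Finset.mem_univ z) h

/-- Second derivatives of a symmetric quadric: `∂_z ∂_x (Σ C(U a b) X_a X_b) = C (2 U x z)`. [folklore] -/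
theorem pderiv_pderiv_quadric (U : Fin 5 → Fin 5 → ℂ) (hU : ∀ a b : Fin 5, U a b = U b a) (x z : Fin 5) :
    pderiv z (pderiv x (∑ a : Fin 5, ∑ b : Fin 5, C (U a b) * X a * X b : MvPolynomial (Fin 5) ℂ))
      = C (2 * U x z) := by
  classical
  rw [pderiv_quadric]
  have h : (∑ b : Fin 5, C (U x b + U b x) * X b : MvPolynomial (Fin 5) ℂ)
      = ∑ b : Fin 5, (U x b + U b x) • (X b : MvPolynomial (Fin 5) ℂ) :=
    Finset.sum_congr rfl fun b _ => by rw [smul_eq_C_mul]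
  rw [h, pderiv_sum_smul_X, hU z x, two_mul]

/-- From `k = α p + β q`: `α · M_{ac} = N_{ac}` and `β · M_{ac} = N'_{ac}` (any commutative ring). [folklore] -/
theorem numerators_of_decomposition {R : Type*} [CommRing R] {ι : Type*} (k p q : ι → R) (α β : R)
    (h : ∀ u, k u = α * p u + β * q u) (a c : ι) :
    α * (p a * q c - p c * q a) = k a * q c - k c * q a ∧ β * (p a * q c - p c * q a) = p a * k c - p c * k a := by
  constructor
  · rw [h a, h c]; ring
  · rw [h a, h c]; ring

/-- **Degree bookkeeping**: if `α · M = N` with `M ≠ 0` a form of degree `m` and `N` a form of degree `d + m`, then `α` is a form of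
degree `d` (divisors of non-zero forms are forms, ✓ `isHomogeneous_of_dvd_isHomogeneous`, and degrees add in a domain). [folklore] -/
theorem isHomogeneous_of_mul_eq {K : Type*} [Field K] {σ : Type*} {α M N : MvPolynomial σ K} {m n d : ℕ}
    (hM : M.IsHomogeneous m) (hM0 : M ≠ 0) (hN : N.IsHomogeneous n) (h : α * M = N) (hd : d + m = n) :
    α.IsHomogeneous d := by
  by_cases hα : α = 0
  · rw [hα]; exact isHomogeneous_zero _ _ _
  have hN0 : N ≠ 0 := by rw [← h]; exact mul_ne_zero hα hM0
  have hαh : α.IsHomogeneous α.totalDegree :=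
    Literature.Computability.AlgebraicComplexity.DeterminantalConormal.isHomogeneous_of_dvd_isHomogeneous hN hN0
      ⟨M, h.symm⟩
  have hdeg : α.totalDegree + M.totalDegree = N.totalDegree := by
    rw [← h, totalDegree_mul_of_isDomain hα hM0]
  rw [hM.totalDegree hM0, hN.totalDegree hN0] at hdeg
  have hαd : α.totalDegree = d := by omega
  rw [hαd] at hαh
  exact hαh

/-- **Hessian exchange identity.**  If `∂_u K = α ∂_u Q₁ + β ∂_u Q₂` with LINEAR forms `α = Σ a_z X_z`, `β = Σ b_z X_z` and symmetric
`U₁, U₂`, then `a_z U₁(x,w) + b_z U₂(x,w) = a_x U₁(z,w) + b_x U₂(z,w)` (symmetry of `∂_z ∂_x K`, evaluated at `e_w`). [folklore] -/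
theorem hessian_exchange (U₁ U₂ : Fin 5 → Fin 5 → ℂ)
    (hU1 : ∀ a b : Fin 5, U₁ a b = U₁ b a) (hU2 : ∀ a b : Fin 5, U₂ a b = U₂ b a)
    (Q₁ Q₂ K : MvPolynomial (Fin 5) ℂ)
    (hQ₁ : Q₁ = ∑ a : Fin 5, ∑ b : Fin 5, C (U₁ a b) * X a * X b)
    (hQ₂ : Q₂ = ∑ a : Fin 5, ∑ b : Fin 5, C (U₂ a b) * X a * X b)
    (a b : Fin 5 → ℂ) (α β : MvPolynomial (Fin 5) ℂ)
    (hα : α = ∑ z : Fin 5, a z • (X z : MvPolynomial (Fin 5) ℂ)) (hβ : β = ∑ z : Fin 5, b z • (X z : MvPolynomial (Fin 5) ℂ))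
    (hI : ∀ u : Fin 5, pderiv u K = α * pderiv u Q₁ + β * pderiv u Q₂) (z x w : Fin 5) :
    a z * U₁ x w + b z * U₂ x w = a x * U₁ z w + b x * U₂ z w := by
  classical
  -- second derivatives of `K` in both orders
  have second : ∀ x z : Fin 5, pderiv z (pderiv x K)
      = C (a z) * pderiv x Q₁ + α * C (2 * U₁ x z) + (C (b z) * pderiv x Q₂ + β * C (2 * U₂ x z)) := by
    intro x z
    rw [hI x, map_add, pderiv_mul, pderiv_mul, hQ₁, pderiv_pderiv_quadric U₁ hU1, ← hQ₁, hQ₂,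
      pderiv_pderiv_quadric U₂ hU2, ← hQ₂, hα, pderiv_sum_smul_X, ← hα, hβ, pderiv_sum_smul_X, ← hβ]
  have hsymm := second x z
  rw [pderiv_comm, second z x, hU1 z x, hU2 z x] at hsymm
  -- the polynomial identity `C(a z) ∂_x Q₁ + C(b z) ∂_x Q₂ = C(a x) ∂_z Q₁ + C(b x) ∂_z Q₂`, evaluated at `e_w`
  have hpoly : C (a z) * pderiv x Q₁ + C (b z) * pderiv x Q₂ = C (a x) * pderiv z Q₁ + C (b x) * pderiv z Q₂ := by
    linear_combination -hsymm
  have ev : ∀ (U : Fin 5 → Fin 5 → ℂ) (hU : ∀ a b : Fin 5, U a b = U b a) (Q : MvPolynomial (Fin 5) ℂ)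
      (hQ : Q = ∑ a : Fin 5, ∑ b : Fin 5, C (U a b) * X a * X b) (c : Fin 5),
      MvPolynomial.eval (Pi.single w (1 : ℂ)) (pderiv c Q) = 2 * U c w := by
    intro U hU Q hQ c
    rw [hQ, eval_pderiv_quadric U hU]
    simp [Pi.single_apply]
  have h := congr_arg (MvPolynomial.eval (Pi.single w (1 : ℂ))) hpoly
  simp only [map_add, map_mul, eval_C, ev U₁ hU1 Q₁ hQ₁, ev U₂ hU2 Q₂ hQ₂] at h
  linear_combination h / 2

/-- **LEMMA K, exit (I) — the endgame.**  Two independent symmetric quadrics `Q₁, Q₂` (`U₁ ∦ U₂`), a cubic `K`, a non-zero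
Jacobian minor `M_{a₀c₀}`, and POLYNOMIALS `α, β` with `∂_u K = α ∂_u Q₁ + β ∂_u Q₂`.  Then the pencil is BINARY (all columns of
`U₁, U₂` in the span of two vectors), or it contains a SQUARE (`s U₁ + t U₂ = λλᵀ`, `(s,t) ≠ 0`), or `K = 0`.
Proof: `α, β` are linear forms (degrees); `hessian_exchange`; then ✓ `columns_in_span_of_symmetric_tensor` (`∇α ∦ ∇β`),
✓ `square_of_symmetric_tensor` (`∇α ∥ ∇β ≠ 0`), Euler (`∇α = ∇β = 0`). [folklore] -/
theorem endgame_of_polynomial_coefficients (U₁ U₂ : Fin 5 → Fin 5 → ℂ) (W : Fin 5 → Fin 5 → Fin 5 → ℂ)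
    (hU1 : ∀ a b : Fin 5, U₁ a b = U₁ b a) (hU2 : ∀ a b : Fin 5, U₂ a b = U₂ b a)
    (hind : ∀ s t : ℂ, (∀ x w : Fin 5, s * U₁ x w + t * U₂ x w = 0) → s = 0 ∧ t = 0)
    (Q₁ Q₂ K : MvPolynomial (Fin 5) ℂ)
    (hQ₁ : Q₁ = ∑ a : Fin 5, ∑ b : Fin 5, C (U₁ a b) * X a * X b)
    (hQ₂ : Q₂ = ∑ a : Fin 5, ∑ b : Fin 5, C (U₂ a b) * X a * X b)
    (hK : K = ∑ a : Fin 5, ∑ b : Fin 5, ∑ c : Fin 5, C (W a b c) * X a * X b * X c)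
    (a₀ c₀ : Fin 5) (h0 : pderiv a₀ Q₁ * pderiv c₀ Q₂ - pderiv c₀ Q₁ * pderiv a₀ Q₂ ≠ 0)
    (α β : MvPolynomial (Fin 5) ℂ) (hI : ∀ u : Fin 5, pderiv u K = α * pderiv u Q₁ + β * pderiv u Q₂) :
    (∃ e f : Fin 5 → ℂ, ∀ d : Fin 5,
        (∃ s t : ℂ, ∀ x : Fin 5, U₁ x d = s * e x + t * f x) ∧ (∃ s t : ℂ, ∀ x : Fin 5, U₂ x d = s * e x + t * f x)) ∨
    (∃ lam : Fin 5 → ℂ, ∃ s t : ℂ, (s ≠ 0 ∨ t ≠ 0) ∧ ∀ x w : Fin 5, s * U₁ x w + t * U₂ x w = lam x * lam w) ∨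
    K = 0 := by
  classical
  -- Step 1: `α`, `β` are linear forms
  have hp : ∀ u : Fin 5, (pderiv u Q₁).IsHomogeneous 1 := fun u => by
    rw [hQ₁]; exact (quadric_isHomogeneous U₁).pderiv
  have hq : ∀ u : Fin 5, (pderiv u Q₂).IsHomogeneous 1 := fun u => by
    rw [hQ₂]; exact (quadric_isHomogeneous U₂).pderiv
  have hk : ∀ u : Fin 5, (pderiv u K).IsHomogeneous 2 := fun u => by
    rw [hK]; exact (cubic_isHomogeneous W).pderiv
  have hM₀ : (pderiv a₀ Q₁ * pderiv c₀ Q₂ - pderiv c₀ Q₁ * pderiv a₀ Q₂).IsHomogeneous 2 :=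
    ((hp a₀).mul (hq c₀)).sub ((hp c₀).mul (hq a₀))
  obtain ⟨hNα, hNβ⟩ := numerators_of_decomposition (fun u => pderiv u K) (fun u => pderiv u Q₁)
    (fun u => pderiv u Q₂) α β hI a₀ c₀
  have hα1 : α.IsHomogeneous 1 :=
    isHomogeneous_of_mul_eq (d := 1) hM₀ h0 (((hk a₀).mul (hq c₀)).sub ((hk c₀).mul (hq a₀))) hNα rfl
  have hβ1 : β.IsHomogeneous 1 :=
    isHomogeneous_of_mul_eq (d := 1) hM₀ h0 (((hp a₀).mul (hk c₀)).sub ((hp c₀).mul (hk a₀))) hNβ rfl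
  set a : Fin 5 → ℂ := fun z => coeff (Finsupp.single z 1) α with ha_def
  set b : Fin 5 → ℂ := fun z => coeff (Finsupp.single z 1) β with hb_def
  have hα : α = ∑ z : Fin 5, a z • (X z : MvPolynomial (Fin 5) ℂ) :=
    Literature.RingTheory.MvPolynomial.eq_sum_coeff_single_one_smul_X hα1
  have hβ : β = ∑ z : Fin 5, b z • (X z : MvPolynomial (Fin 5) ℂ) :=
    Literature.RingTheory.MvPolynomial.eq_sum_coeff_single_one_smul_X hβ1
  -- Step 2: the Hessian exchange identity
  have hsym : ∀ z x w : Fin 5, a z * U₁ x w + b z * U₂ x w = a x * U₁ z w + b x * U₂ z w :=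
    hessian_exchange U₁ U₂ hU1 hU2 Q₁ Q₂ K hQ₁ hQ₂ a b α β hα hβ hI
  -- Step 3: trichotomy on the pair of constant vectors `(a, b)`
  by_cases hD : ∃ i j : Fin 5, a i * b j - a j * b i ≠ 0
  · -- `a ∦ b`: binary
    obtain ⟨i, j, hDij⟩ := hD
    refine Or.inl ⟨a, b, fun d => ⟨?_, ?_⟩⟩
    · refine ⟨(b j * U₁ i d - b i * U₁ j d) / (a i * b j - a j * b i),
        (b j * U₂ i d - b i * U₂ j d) / (a i * b j - a j * b i), fun x => ?_⟩
      have hx := (columns_in_span_of_symmetric_tensor a b U₁ U₂ hsym i j x d).1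
      rw [div_mul_eq_mul_div, div_mul_eq_mul_div, ← add_div, eq_div_iff hDij]
      linear_combination hx
    · refine ⟨(a i * U₁ j d - a j * U₁ i d) / (a i * b j - a j * b i),
        (a i * U₂ j d - a j * U₂ i d) / (a i * b j - a j * b i), fun x => ?_⟩
      have hx := (columns_in_span_of_symmetric_tensor a b U₁ U₂ hsym i j x d).2
      rw [div_mul_eq_mul_div, div_mul_eq_mul_div, ← add_div, eq_div_iff hDij]
      linear_combination hx
  · have hD' : ∀ i j : Fin 5, a i * b j - a j * b i = 0 := by
      intro i j
      by_contra h
      exact hD ⟨i, j, h⟩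
    -- the square case, for `a = s₀ • lam`, `b = t₀ • lam`
    have square_case : ∀ (lam : Fin 5 → ℂ) (s₀ t₀ : ℂ), (s₀ ≠ 0 ∨ t₀ ≠ 0) → (∃ z₀, lam z₀ ≠ 0) →
        (∀ z, a z = s₀ * lam z) → (∀ z, b z = t₀ * lam z) →
        (∃ lam : Fin 5 → ℂ, ∃ s t : ℂ, (s ≠ 0 ∨ t ≠ 0) ∧ ∀ x w : Fin 5, s * U₁ x w + t * U₂ x w = lam x * lam w) := by
      intro lam s₀ t₀ hst ⟨z₀, hz₀⟩ haz hbz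
      have hM : ∀ x w : Fin 5, s₀ * U₁ x w + t₀ * U₂ x w = s₀ * U₁ w x + t₀ * U₂ w x := fun x w => by
        rw [hU1 x w, hU2 x w]
      have hlam : ∀ z x w : Fin 5, lam z * (s₀ * U₁ x w + t₀ * U₂ x w) = lam x * (s₀ * U₁ z w + t₀ * U₂ z w) := by
        intro z x w
        have h := hsym z x w
        rw [haz z, haz x, hbz z, hbz x] at h
        linear_combination h
      have hsq := square_of_symmetric_tensor lam (fun x w => s₀ * U₁ x w + t₀ * U₂ x w) hM hlam z₀
      set c : ℂ := (s₀ * U₁ z₀ z₀ + t₀ * U₂ z₀ z₀) / (lam z₀ * lam z₀) with hc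
      by_cases hc0 : s₀ * U₁ z₀ z₀ + t₀ * U₂ z₀ z₀ = 0
      · -- then `s₀ U₁ + t₀ U₂ = 0`, contradicting independence
        exfalso
        have hzero : ∀ x w : Fin 5, s₀ * U₁ x w + t₀ * U₂ x w = 0 := by
          intro x w
          have h := hsq x w
          rw [hc0, zero_mul] at h
          have hl : lam z₀ * lam z₀ ≠ 0 := mul_ne_zero hz₀ hz₀
          exact (mul_eq_zero.mp h).resolve_left hl
        obtain ⟨hs, ht⟩ := hind s₀ t₀ hzero
        rcases hst with h | h
        · exact h hs
        · exact h ht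
      · refine ⟨lam, s₀ / c, t₀ / c, ?_, fun x w => ?_⟩
        · have hcne : c ≠ 0 := div_ne_zero hc0 (mul_ne_zero hz₀ hz₀)
          rcases hst with h | h
          · exact Or.inl (div_ne_zero h hcne)
          · exact Or.inr (div_ne_zero h hcne)
        · have h := hsq x w
          rw [hc]
          field_simp
          linear_combination h
    by_cases ha0 : ∃ i₀, a i₀ ≠ 0
    · obtain ⟨i₀, hi₀⟩ := ha0
      refine Or.inr (Or.inl (square_case a 1 (b i₀ / a i₀) (Or.inl one_ne_zero) ⟨i₀, hi₀⟩
        (fun z => by rw [one_mul]) fun z => ?_))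
      have h := hD' i₀ z
      field_simp
      linear_combination h
    · have ha : ∀ i, a i = 0 := by
        intro i
        by_contra h
        exact ha0 ⟨i, h⟩
      by_cases hb0 : ∃ i₀, b i₀ ≠ 0
      · obtain ⟨i₀, hi₀⟩ := hb0
        exact Or.inr (Or.inl (square_case b 0 1 (Or.inr one_ne_zero) ⟨i₀, hi₀⟩
          (fun z => by rw [ha z, zero_mul]) fun z => by rw [one_mul]))
      · have hb : ∀ i, b i = 0 := by
          intro i
          by_contra h
          exact hb0 ⟨i, h⟩
        -- `α = β = 0`, hence `∂K = 0` and `K = 0` by Euler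
        refine Or.inr (Or.inr ?_)
        have hα0 : α = 0 := by
          rw [hα]
          exact Finset.sum_eq_zero fun z _ => by rw [ha z, zero_smul]
        have hβ0 : β = 0 := by
          rw [hβ]
          exact Finset.sum_eq_zero fun z _ => by rw [hb z, zero_smul]
        have hdK : ∀ u : Fin 5, pderiv u K = 0 := fun u => by
          rw [hI u, hα0, hβ0, zero_mul, zero_mul, add_zero]
        have heuler := euler_cubic W
        rw [← hK] at heuler
        have h3 : (3 : ℕ) • K = 0 := by
          rw [← heuler]
          exact Finset.sum_eq_zero fun u _ => by rw [hdK u, mul_zero]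
        rw [nsmul_eq_mul] at h3
        have h3' : ((3 : ℕ) : MvPolynomial (Fin 5) ℂ) ≠ 0 := by exact_mod_cast (by norm_num : (3 : ℕ) ≠ 0)
        exact (mul_eq_zero.mp h3).resolve_left h3'

end LaplaceFiveStar

end Summit.ValiantsHypothesis.ValiantsHypothesis.Theorems.RigidityForcesSymmetryRankRigidMinimalRepr
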